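import Summits.AnomalousDissipation.AnomalousDissipation.Theses.KolmogorovPincer
import Summits.AnomalousDissipation.AnomalousDissipation.Theorems.CellRoutesTaylorGreenForceRegularTG
import Literature.Analysis.FluidPDE.DoeringFoiasProofs
import Literature.Analysis.FluidPDE.LerayHopfSpectralMeasurability
import Literature.Analysis.FluidPDE.AlexakisDoeringInterpolation
import Literature.Analysis.FluidPDE.LongTimeAverageNonneg
import Literature.Analysis.FunctionSpaces.BesovDifference
import Literature.Analysis.FunctionSpaces.TorusTranslationEstimate
import Literature.Analysis.FunctionSpaces.TorusMaximalLipschitz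
import Literature.Analysis.FunctionSpaces.TorusMollifier
import Literature.Analysis.FunctionSpaces.FlatTorus

/-!
# Support item `KolmogorovPincer.IncrementPincerTG` (stmt-AnomalousDissipation-32241), proved

Route `KolmogorovPincer` (decomp-ad cell, child of `RootDecompCycle1` on the blocker `RestMeanFloorTG`):
the INCREMENT PINCER is the theorem-grade glue of the route's deciding theorem `closes` (binder `hP`).
Index the dissipative-scale statistics of a Leray–Hopf field on `T³` by the Nikol'skii–Besov point
`(σ, p)`, `N_{σ,p}(v) := [v]_{B^σ_{p,∞}}` (tree `eBesovSupSeminorm σ p`).  On the ε-isoline `p(1+σ) = 4`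
the three points `(1,2)`, `(3/4,16/7)`, `(1/2,8/3)` are tied by same-function `L^p` interpolation
(`7/16 = ½·½ + ½·⅜`) and the `H¹` corner `N_{1,2} ≤ √3 ‖∇v‖₂` (DiPerna–Lions 1989, Lemma II.1, torus form):
`N_{3/4,16/7}(v)² ≤ √3 ‖∇v‖₂ N_{1/2,8/3}(v)`, i.e. in K41 weights `X² ≤ 3·D·Y` pointwise in time with
`X := ν^{5/8} N_{3/4,16/7}²`, `Y := ν^{1/4} N_{1/2,8/3}²`, `D := ν‖∇u‖²`.  Cauchy–Schwarz in time
(tree `timeMean_le_sqrt_timeMean_mul_timeMean`), the from-rest a-priori bound on the dissipation means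
(tree `Torus.IsLerayHopfOn.intervalIntegral_power_bounds`, `E₀ = 0`) and `limsup = sInf` of eventual upper
bounds give: if the `X`-signal has limsup-mean `≥ ε > 0` and the `Y`-signal satisfies the membership
clauses (a),(b) and has running means eventually `≤ M`, then `ε²/(3M) ≤ meanDissipation ν u` — for EVERY
`ν > 0` and every global Leray–Hopf solution from rest at the Taylor–Green force (no uniformity in ν).
The closed item `TaylorGreenForceRegularTG` (stmt-24257) enters BY NAME through the landed
`Theorems.TaylorGreenForceRegular.kolmogorovPincer_taylorGreenForceRegularTG`.
Ported verbatim (by name against the route file) from the decomp-ad lens-1 g13 node file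
`KolmogorovPincer.lean` (kernel-checked there 2026-08-30); landed by the cell's prover seat.
Nothing here proves the summit or either jaw.  References: Frisch 1995 §8.5.5; Doering–Foias 2002 §2;
DiPerna–Lions 1989 Lemma II.1. [folklore estimates]
-/

set_option linter.dupNamespace false

noncomputable section

namespace Summit.AnomalousDissipation.AnomalousDissipation.Theorems.KolmogorovPincerIncrementPincerTG

open scoped BigOperators Topology Manifold Classical MeasureTheory ProbabilityTheory Matrix InnerProductSpace ComplexConjugate ContinuousMap
open Filter Set Function TopologicalSpace MeasureTheory

open Literature.Turb
open scoped ENNReal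
open Literature.Analysis.FunctionSpaces
open Summit.AnomalousDissipation.AnomalousDissipation.Theses

section LpInterp

variable {α : Type*} [MeasurableSpace α] {μ : Measure α} {E : Type*} [NormedAddCommGroup E]

/-- Exponent bookkeeping for the `L²`–`L^{8/3}` interpolation: `x^{16/7} = (x²)^{4/7} · (x^{8/3})^{3/7}`.
(Docstring added at landing, census g17 — gate `lint.docstring`; statement and proof unchanged.) -/
private lemma rpow_split (x : ℝ≥0∞) :
    x ^ (16 / 7 : ℝ) = (x ^ (2 : ℝ)) ^ (4 / 7 : ℝ) * (x ^ (8 / 3 : ℝ)) ^ (3 / 7 : ℝ) := by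
  rw [← ENNReal.rpow_mul, ← ENNReal.rpow_mul,
    ← ENNReal.rpow_add_of_nonneg _ _ (by norm_num) (by norm_num)]
  norm_num

/-- Hölder form: `∫ |g|^{16/7} ≤ (∫ |g|²)^{4/7} (∫ |g|^{8/3})^{3/7}`. -/
theorem lintegral_rpow_sixteen_sevenths_le {g : α → E} (hg : AEStronglyMeasurable g μ) :
    ∫⁻ a, ‖g a‖ₑ ^ (16 / 7 : ℝ) ∂μ ≤
      (∫⁻ a, ‖g a‖ₑ ^ (2 : ℝ) ∂μ) ^ (4 / 7 : ℝ) * (∫⁻ a, ‖g a‖ₑ ^ (8 / 3 : ℝ) ∂μ) ^ (3 / 7 : ℝ) := by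
  have h := ENNReal.lintegral_mul_norm_pow_le (μ := μ) (f := fun a => ‖g a‖ₑ ^ (2 : ℝ))
    (g := fun a => ‖g a‖ₑ ^ (8 / 3 : ℝ)) (hg.enorm.pow_const _) (hg.enorm.pow_const _)
    (p := 4 / 7) (q := 3 / 7) (by norm_num) (by norm_num) (by norm_num)
  simp_rw [rpow_split]
  exact h

/-- **Same-function `L^p` interpolation on the ε-isoline**:
`‖g‖_{16/7} ≤ ‖g‖₂^{1/2} ‖g‖_{8/3}^{1/2}` (`7/16 = ½·½ + ½·⅜`). -/
theorem eLpNorm_sixteen_sevenths_le {g : α → E} (hg : AEStronglyMeasurable g μ) :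
    eLpNorm g (16 / 7 : ℝ≥0∞) μ ≤
      eLpNorm g 2 μ ^ (1 / 2 : ℝ) * eLpNorm g (8 / 3 : ℝ≥0∞) μ ^ (1 / 2 : ℝ) := by
  have h167_0 : (16 / 7 : ℝ≥0∞) ≠ 0 := by simp
  have h167_t : (16 / 7 : ℝ≥0∞) ≠ ⊤ := by simp [ENNReal.div_eq_top]
  have h83_0 : (8 / 3 : ℝ≥0∞) ≠ 0 := by simp
  have h83_t : (8 / 3 : ℝ≥0∞) ≠ ⊤ := by simp [ENNReal.div_eq_top]
  have t167 : (16 / 7 : ℝ≥0∞).toReal = 16 / 7 := by rw [ENNReal.toReal_div]; norm_num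
  have t83 : (8 / 3 : ℝ≥0∞).toReal = 8 / 3 := by rw [ENNReal.toReal_div]; norm_num
  rw [eLpNorm_eq_lintegral_rpow_enorm_toReal h167_0 h167_t,
    eLpNorm_eq_lintegral_rpow_enorm_toReal two_ne_zero ENNReal.ofNat_ne_top,
    eLpNorm_eq_lintegral_rpow_enorm_toReal h83_0 h83_t, t167, t83, ENNReal.toReal_ofNat]
  have h := lintegral_rpow_sixteen_sevenths_le (μ := μ) hg
  calc (∫⁻ a, ‖g a‖ₑ ^ (16 / 7 : ℝ) ∂μ) ^ (1 / (16 / 7 : ℝ))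
      ≤ ((∫⁻ a, ‖g a‖ₑ ^ (2 : ℝ) ∂μ) ^ (4 / 7 : ℝ) *
          (∫⁻ a, ‖g a‖ₑ ^ (8 / 3 : ℝ) ∂μ) ^ (3 / 7 : ℝ)) ^ (1 / (16 / 7 : ℝ)) :=
        ENNReal.rpow_le_rpow h (by norm_num)
    _ = ((∫⁻ a, ‖g a‖ₑ ^ (2 : ℝ) ∂μ) ^ (1 / (2 : ℝ))) ^ (1 / 2 : ℝ) *
          ((∫⁻ a, ‖g a‖ₑ ^ (8 / 3 : ℝ) ∂μ) ^ (1 / (8 / 3 : ℝ))) ^ (1 / 2 : ℝ) := by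
        rw [ENNReal.mul_rpow_of_nonneg _ _ (by norm_num), ← ENNReal.rpow_mul, ← ENNReal.rpow_mul,
          ← ENNReal.rpow_mul, ← ENNReal.rpow_mul]
        norm_num

end LpInterp

section Torus

/-- **`H¹ ⊂ B¹_{2,∞}` quantitatively** on `T³`: `[u]_{B¹_{2,∞}} ≤ √3 (eGradNormSq u)^{1/2}` for
`u ∈ L²(T³; ℝ³)` — the tree's `Literature.Barriers.AnomalousDissipation.SobolevCorner.eBesovSupSeminorm_one_two_le`
at `d = Fin 3`, re-derived here from `Torus.eLpNorm_sub_translate_le` (DiPerna–Lions 1989, Lemma II.1,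
torus form) so that this file does not depend on the barrier module. [folklore] -/
theorem eBesovSupSeminorm_one_two_le_sqrt_three {u : UnitAddTorus (Fin 3) → EuclideanSpace ℝ (Fin 3)}
    (hu : MemLp u 2 volume) :
    eBesovSupSeminorm 1 2 u volume ≤
      ENNReal.ofReal (Real.sqrt 3) * Torus.eGradNormSq u ^ (1 / 2 : ℝ) := by
  rw [eBesovSupSeminorm_def]
  refine iSup₂_le fun h hh => ?_
  rw [ENNReal.div_le_iff (ofReal_norm_rpow_pos 1 hh).ne' ENNReal.ofReal_ne_top]
  have h1 := Torus.eLpNorm_sub_translate_le hu (Torus.reprc h)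
  rw [Torus.proj_reprc] at h1
  have h3 : ‖Torus.reprc h‖ ≤ Real.sqrt 3 * ‖h‖ := by
    simpa [Fintype.card_fin] using Torus.norm_reprc_le_sqrt_card_mul_norm h
  calc eLpNorm (fun x => u (x + h) - u x) 2 volume
      ≤ ENNReal.ofReal ‖Torus.reprc h‖ * Torus.eGradNormSq u ^ (1 / 2 : ℝ) := h1
    _ ≤ ENNReal.ofReal (Real.sqrt 3 * ‖h‖) * Torus.eGradNormSq u ^ (1 / 2 : ℝ) := by
        gcongr
    _ = ENNReal.ofReal (Real.sqrt 3) * Torus.eGradNormSq u ^ (1 / 2 : ℝ) *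
          ENNReal.ofReal (‖h‖ ^ (1 : ℝ)) := by
        rw [Real.rpow_one, ENNReal.ofReal_mul (Real.sqrt_nonneg _)]
        ring


/-- **Besov pincer along the ε-isoline** (no measurability beyond a.e.-strong measurability):
`[v]_{B^{3/4}_{16/7,∞}} ≤ ([v]_{B^1_{2,∞}} · [v]_{B^{1/2}_{8/3,∞}})^{1/2}`. -/
theorem eBesovSupSeminorm_isoline_le {v : UnitAddTorus (Fin 3) → EuclideanSpace ℝ (Fin 3)}
    (hv : AEStronglyMeasurable v volume) :
    eBesovSupSeminorm (3 / 4 : ℝ) (16 / 7 : ℝ≥0∞) v volume ≤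
      (eBesovSupSeminorm 1 2 v volume *
        eBesovSupSeminorm (1 / 2 : ℝ) (8 / 3 : ℝ≥0∞) v volume) ^ (1 / 2 : ℝ) := by
  set N₁ := eBesovSupSeminorm 1 2 v volume with hN₁
  set NC := eBesovSupSeminorm (1 / 2 : ℝ) (8 / 3 : ℝ≥0∞) v volume with hNC
  rw [eBesovSupSeminorm_def]
  refine iSup₂_le fun h hh => ?_
  have hpos : 0 < ‖h‖ := norm_pos_iff.2 hh
  rw [ENNReal.div_le_iff (ofReal_norm_rpow_pos _ hh).ne' ENNReal.ofReal_ne_top]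
  have hg : AEStronglyMeasurable (fun x => v (x + h) - v x) volume :=
    (aestronglyMeasurable_comp_add_right hv h).sub hv
  have h2 : eLpNorm (fun x => v (x + h) - v x) 2 volume ≤ N₁ * ENNReal.ofReal (‖h‖ ^ (1 : ℝ)) :=
    eLpNorm_sub_le_eBesovSupSeminorm_mul hh
  have h83 : eLpNorm (fun x => v (x + h) - v x) (8 / 3 : ℝ≥0∞) volume ≤
      NC * ENNReal.ofReal (‖h‖ ^ (1 / 2 : ℝ)) :=
    eLpNorm_sub_le_eBesovSupSeminorm_mul hh
  calc eLpNorm (fun x => v (x + h) - v x) (16 / 7 : ℝ≥0∞) volume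
      ≤ eLpNorm (fun x => v (x + h) - v x) 2 volume ^ (1 / 2 : ℝ) *
          eLpNorm (fun x => v (x + h) - v x) (8 / 3 : ℝ≥0∞) volume ^ (1 / 2 : ℝ) :=
        eLpNorm_sixteen_sevenths_le hg
    _ ≤ (N₁ * ENNReal.ofReal (‖h‖ ^ (1 : ℝ))) ^ (1 / 2 : ℝ) *
          (NC * ENNReal.ofReal (‖h‖ ^ (1 / 2 : ℝ))) ^ (1 / 2 : ℝ) := by
        gcongr
    _ = (N₁ * NC) ^ (1 / 2 : ℝ) * ENNReal.ofReal (‖h‖ ^ (3 / 4 : ℝ)) := by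
        rw [ENNReal.mul_rpow_of_nonneg _ _ (by norm_num), ENNReal.mul_rpow_of_nonneg _ _ (by norm_num),
          ENNReal.mul_rpow_of_nonneg _ _ (by norm_num),
          ENNReal.ofReal_rpow_of_nonneg (by positivity) (by norm_num),
          ENNReal.ofReal_rpow_of_nonneg (by positivity) (by norm_num),
          ← Real.rpow_mul hpos.le, ← Real.rpow_mul hpos.le, mul_mul_mul_comm,
          ← ENNReal.ofReal_mul (by positivity), ← Real.rpow_add hpos]
        norm_num

/-- **The increment pincer, squared, with the `H¹` corner**:
`[v]²_{B^{3/4}_{16/7,∞}} ≤ √3 · (eGradNormSq v)^{1/2} · [v]_{B^{1/2}_{8/3,∞}}` for `v ∈ L²(T³;ℝ³)`.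
With `X = ν^{5/8}[u]²_{B^{3/4}_{16/7,∞}}`, `Y = ν^{1/4}[u]²_{B^{1/2}_{8/3,∞}}`, `D = ν‖∇u‖²` this
reads `X² ≤ 3·D·Y`. -/
theorem eBesovSupSeminorm_isoline_sq_le {v : UnitAddTorus (Fin 3) → EuclideanSpace ℝ (Fin 3)}
    (hv : MemLp v 2 volume) :
    eBesovSupSeminorm (3 / 4 : ℝ) (16 / 7 : ℝ≥0∞) v volume ^ 2 ≤
      ENNReal.ofReal (Real.sqrt 3) * Torus.eGradNormSq v ^ (1 / 2 : ℝ) *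
        eBesovSupSeminorm (1 / 2 : ℝ) (8 / 3 : ℝ≥0∞) v volume := by
  have h1 := eBesovSupSeminorm_isoline_le hv.aestronglyMeasurable
  have h2 : eBesovSupSeminorm 1 2 v volume ≤
      ENNReal.ofReal (Real.sqrt 3) * Torus.eGradNormSq v ^ (1 / 2 : ℝ) :=
    eBesovSupSeminorm_one_two_le_sqrt_three hv
  calc eBesovSupSeminorm (3 / 4 : ℝ) (16 / 7 : ℝ≥0∞) v volume ^ 2
      ≤ ((eBesovSupSeminorm 1 2 v volume *
          eBesovSupSeminorm (1 / 2 : ℝ) (8 / 3 : ℝ≥0∞) v volume) ^ (1 / 2 : ℝ)) ^ 2 :=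
        by gcongr
    _ = eBesovSupSeminorm 1 2 v volume *
          eBesovSupSeminorm (1 / 2 : ℝ) (8 / 3 : ℝ≥0∞) v volume := by
        rw [← ENNReal.rpow_two, ← ENNReal.rpow_mul]
        norm_num
    _ ≤ _ := by
        gcongr

end Torus

section PincerProof

open Literature.Analysis.FunctionSpaces Literature.Analysis.FluidPDE

/-- Real form of the pointwise pincer in K41 weights: `X² ≤ (3·D)·Y` at a time slice `v = u(t)`
with `v ∈ L²`, `‖∇v‖₂ < ∞` and `[v]_{B^{1/2}_{8/3,∞}} < ∞`. -/
theorem pincer_sq_le_real {ν : ℝ} (hν : 0 < ν) {v : UnitAddTorus (Fin 3) → EuclideanSpace ℝ (Fin 3)}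
    (hv : MemLp v 2 volume) (hG : Torus.eGradNormSq v < ⊤)
    (hC : eBesovSupSeminorm (1 / 2 : ℝ) (8 / 3 : ENNReal) v volume < ⊤) :
    (ν ^ (5 / 8 : ℝ) * ((eBesovSupSeminorm (3 / 4 : ℝ) (16 / 7 : ENNReal) v volume) ^ 2).toReal) ^ 2 ≤
      (3 * (ν * (Torus.eGradNormSq v).toReal)) *
        (ν ^ (1 / 4 : ℝ) * ((eBesovSupSeminorm (1 / 2 : ℝ) (8 / 3 : ENNReal) v volume) ^ 2).toReal) := by
  set NF := eBesovSupSeminorm (3 / 4 : ℝ) (16 / 7 : ENNReal) v volume with hNF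
  set NC := eBesovSupSeminorm (1 / 2 : ℝ) (8 / 3 : ENNReal) v volume with hNC
  set G := Torus.eGradNormSq v with hGdef
  have key : NF ^ 2 ≤ ENNReal.ofReal (Real.sqrt 3) * G ^ (1 / 2 : ℝ) * NC :=
    eBesovSupSeminorm_isoline_sq_le hv
  have hRHS : ENNReal.ofReal (Real.sqrt 3) * G ^ (1 / 2 : ℝ) * NC ≠ ⊤ := by
    refine ENNReal.mul_ne_top (ENNReal.mul_ne_top ENNReal.ofReal_ne_top ?_) hC.ne
    exact (ENNReal.rpow_lt_top_of_nonneg (by norm_num) hG.ne).ne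
  have h1 : (NF ^ 2).toReal ≤ Real.sqrt 3 * G.toReal ^ (1 / 2 : ℝ) * NC.toReal := by
    have := ENNReal.toReal_mono hRHS key
    rwa [ENNReal.toReal_mul, ENNReal.toReal_mul, ENNReal.toReal_ofReal (Real.sqrt_nonneg _),
      ← ENNReal.toReal_rpow] at this
  have h0 : 0 ≤ (NF ^ 2).toReal := ENNReal.toReal_nonneg
  have hG0 : 0 ≤ G.toReal := ENNReal.toReal_nonneg
  have h2 : (NF ^ 2).toReal ^ 2 ≤ 3 * G.toReal * (NC ^ 2).toReal := by
    calc (NF ^ 2).toReal ^ 2 ≤ (Real.sqrt 3 * G.toReal ^ (1 / 2 : ℝ) * NC.toReal) ^ 2 := by gcongr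
      _ = Real.sqrt 3 ^ 2 * (G.toReal ^ (1 / 2 : ℝ)) ^ 2 * NC.toReal ^ 2 := by ring
      _ = 3 * G.toReal * (NC ^ 2).toReal := by
          rw [Real.sq_sqrt (by norm_num : (0 : ℝ) ≤ 3), ← Real.rpow_natCast (G.toReal ^ (1 / 2 : ℝ)) 2,
            ← Real.rpow_mul hG0, ENNReal.toReal_pow]
          norm_num
  have hν58 : (ν ^ (5 / 8 : ℝ)) ^ 2 = ν * ν ^ (1 / 4 : ℝ) := by
    rw [sq, ← Real.rpow_add hν, show (5 / 8 : ℝ) + 5 / 8 = 1 + 1 / 4 by norm_num,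
      Real.rpow_add hν, Real.rpow_one]
  calc (ν ^ (5 / 8 : ℝ) * (NF ^ 2).toReal) ^ 2
      = (ν ^ (5 / 8 : ℝ)) ^ 2 * (NF ^ 2).toReal ^ 2 := mul_pow _ _ _
    _ ≤ (ν * ν ^ (1 / 4 : ℝ)) * (3 * G.toReal * (NC ^ 2).toReal) := by
        rw [hν58]
        gcongr
    _ = _ := by ring

/-- **Route decl `KolmogorovPincer.IncrementPincerTG` (stmt-AnomalousDissipation-32241), proved.**
Proof = the pointwise pincer at a.e. time (`pincer_sq_le_real`, with `‖∇u(t)‖₂ < ∞` a.e. from the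
Leray–Hopf gradient integrability and guard (a)), Cauchy–Schwarz in time (tree
`timeMean_le_sqrt_timeMean_mul_timeMean`), the from-rest a-priori bound on the dissipation means (tree
`Torus.IsLerayHopfOn.intervalIntegral_power_bounds`, `E₀ = 0`), and `limsup = sInf` of eventual upper
bounds; the force clauses come from the landed `kolmogorovPincer_taylorGreenForceRegularTG` (item 24257).
[folklore] -/
theorem kolmogorovPincer_incrementPincerTG : KolmogorovPincer.IncrementPincerTG := by
  intro f hf ν hν u hu ε M hε hM hXε ha hb hc
  obtain ⟨T₀, hc⟩ := hc
  obtain ⟨hfs, -, hfz⟩ := TaylorGreenForceRegular.kolmogorovPincer_taylorGreenForceRegularTG f hf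
  have hf2 : MemLp f 2 volume := hfs.memLp 2
  -- the three signals
  set X : ℝ → ℝ := fun t => ν ^ (5 / 8 : ℝ) *
    ((eBesovSupSeminorm (3 / 4 : ℝ) (16 / 7 : ENNReal) (u t) volume) ^ 2).toReal with hXdef
  set Y : ℝ → ℝ := fun t => ν ^ (1 / 4 : ℝ) *
    ((eBesovSupSeminorm (1 / 2 : ℝ) (8 / 3 : ENNReal) (u t) volume) ^ 2).toReal with hYdef
  set D : ℝ → ℝ := fun t => ν * (Torus.eGradNormSq (u t)).toReal with hDdef
  have hX0 : ∀ t, 0 ≤ X t := fun t => by positivity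
  have hY0 : ∀ t, 0 ≤ Y t := fun t => by positivity
  have hD0 : ∀ t, 0 ≤ D t := fun t => by positivity
  -- (1) dissipation means: integrable and uniformly bounded (from rest, `E₀ = 0`)
  set A : ℝ := (4 * Real.pi ^ 2 * ν)⁻¹ / 2 * ∫ x, ‖f x‖ ^ 2 with hA
  have hKE : Torus.kineticEnergy (0 : UnitAddTorus (Fin 3) → EuclideanSpace ℝ (Fin 3)) = 0 := by
    simp [Torus.kineticEnergy]
  have hDT : ∀ T, 0 < T → IntervalIntegrable D volume 0 T ∧ timeMean D T ≤ 2 * A := by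
    intro T hT
    have hLH := hu T hT
    refine ⟨(hLH.intervalIntegral_dissipation_eq hT).1, ?_⟩
    have hbd := (hLH.intervalIntegral_power_bounds hT hν hf2 hfz).1
    rw [hKE] at hbd
    unfold timeMean
    rw [inv_mul_le_iff₀ hT]
    calc ∫ t in (0 : ℝ)..T, D t ≤ 2 * 0 + 2 * A * T := hbd
      _ = T * (2 * A) := by ring
  -- (2) the squared running-mean inequality `⟨X⟩_T² ≤ 3 M ⟨D⟩_T` for `T ≥ T₀`, `T > 0`
  have hsq : ∀ T, 0 < T → T₀ ≤ T → (timeMean X T) ^ 2 ≤ 3 * M * timeMean D T := by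
    intro T hT hTT
    have hDm := hDT T hT
    have hDnn : 0 ≤ timeMean D T := timeMean_nonneg hD0 hT.le
    by_cases hXm : AEStronglyMeasurable X (volume.restrict (Set.Ioc 0 T))
    · have hLH := hu T hT
      have hGfin : ∀ᵐ t ∂(volume.restrict (Set.Ioc 0 T)), Torus.eGradNormSq (u t) < ⊤ := by
        have h1 : ∀ᵐ t ∂(volume.restrict (Set.Ioo 0 T)), Torus.eGradNormSq (u t) < ⊤ :=
          ae_lt_top' hLH.aemeasurable_eGradNormSq hLH.lintegral_eGradNormSq_lt_top.ne
        rw [← Measure.restrict_congr_set (Ioo_ae_eq_Ioc (μ := (volume : Measure ℝ)) (a := 0) (b := T))]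
        exact h1
      have haT : ∀ᵐ t ∂(volume.restrict (Set.Ioc 0 T)),
          eBesovSupSeminorm (1 / 2 : ℝ) (8 / 3 : ENNReal) (u t) volume < ⊤ :=
        ae_restrict_of_ae_restrict_of_subset Set.Ioc_subset_Ioi_self ha
      have hmem : ∀ᵐ t ∂(volume.restrict (Set.Ioc 0 T)), t ∈ Set.Ioc 0 T :=
        ae_restrict_mem measurableSet_Ioc
      have hGEL : ∀ᵐ t ∂(volume.restrict (Set.Ioc 0 T)), X t ^ 2 ≤ (3 * D t) * Y t := by
        filter_upwards [hGfin, haT, hmem] with t hGt hCt htmem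
        exact pincer_sq_le_real hν (hu.memLp_two htmem.1.le) hGt hCt
      have hE3 : IntegrableOn (fun t => 3 * D t) (Set.Ioc 0 T) :=
        ((intervalIntegrable_iff_integrableOn_Ioc_of_le hT.le).1 hDm.1).const_mul 3
      have hCS := timeMean_le_sqrt_timeMean_mul_timeMean (G := X) (E := fun t => 3 * D t) (L := Y) hT
        (ae_of_all _ fun t => hX0 t) (ae_of_all _ fun t => mul_nonneg (by norm_num) (hD0 t))
        (ae_of_all _ fun t => hY0 t) hGEL hXm hE3 (hb T hT)
      rw [timeMean_const_mul 3 D T] at hCS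
      have hXnn : 0 ≤ timeMean X T := timeMean_nonneg hX0 hT.le
      have hYnn : 0 ≤ timeMean Y T := timeMean_nonneg hY0 hT.le
      have hYle : timeMean Y T ≤ M := hc T hTT
      have hprod : 0 ≤ 3 * timeMean D T * timeMean Y T := by positivity
      calc (timeMean X T) ^ 2 ≤ (Real.sqrt (3 * timeMean D T * timeMean Y T)) ^ 2 := by gcongr
        _ = 3 * timeMean D T * timeMean Y T := Real.sq_sqrt hprod
        _ ≤ 3 * timeMean D T * M := by gcongr
        _ = 3 * M * timeMean D T := by ring
    · have h0 : timeMean X T = 0 := by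
        unfold timeMean
        rw [intervalIntegral.integral_of_le hT.le, integral_non_aestronglyMeasurable hXm, mul_zero]
      rw [h0, zero_pow two_ne_zero]
      positivity
  -- (3) every eventual upper bound `b` of the dissipation means dominates `ε² / (3M)`
  have hbound : ∀ b : ℝ, (∀ᶠ T in atTop, timeMean D T ≤ b) → ε ^ 2 / (3 * M) ≤ b := by
    intro b hbev
    have hev : ∀ᶠ T in atTop, timeMean X T ≤ Real.sqrt (3 * M * b) := by
      filter_upwards [hbev, eventually_gt_atTop 0, eventually_ge_atTop T₀] with T hTb hT hTT
      have h2 : (timeMean X T) ^ 2 ≤ 3 * M * b := (hsq T hT hTT).trans (by gcongr)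
      exact (le_abs_self _).trans (Real.abs_le_sqrt h2)
    have hco : IsCoboundedUnder (· ≤ ·) atTop (timeMean X) :=
      isCoboundedUnder_le_of_eventually_le atTop
        ((eventually_ge_atTop 0).mono fun T hT => timeMean_nonneg hX0 hT)
    have hlim : longTimeAvgSup X ≤ Real.sqrt (3 * M * b) := limsup_le_of_le hco hev
    have hεle : ε ≤ Real.sqrt (3 * M * b) := hXε.trans hlim
    have h3 : ε ^ 2 ≤ 3 * M * b := by
      have hb0 : 0 ≤ 3 * M * b := by
        by_contra hneg
        push Not at hneg
        have : Real.sqrt (3 * M * b) = 0 := Real.sqrt_eq_zero'.2 hneg.le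
        linarith
      calc ε ^ 2 ≤ (Real.sqrt (3 * M * b)) ^ 2 := by gcongr
        _ = 3 * M * b := Real.sq_sqrt hb0
    rw [div_le_iff₀ (by positivity)]
    linarith
  -- (4) `meanDissipation = limsup = sInf {eventual upper bounds}`
  show ε ^ 2 / (3 * M) ≤ meanDissipation ν u
  unfold meanDissipation longTimeAvgSup
  rw [Filter.limsup_eq]
  exact le_csInf ⟨2 * A, (eventually_gt_atTop 0).mono fun T hT => (hDT T hT).2⟩ fun b hb => hbound b hb

end PincerProof

end Summit.AnomalousDissipation.AnomalousDissipation.Theorems.KolmogorovPincerIncrementPincerTG
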